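import Summits.AtomisticToContinuum.HydrodynamicLimit.Theorems.CollisionIsometryCLTDiffuseBackwardInfluenceOnePathExchange
import Summits.AtomisticToContinuum.HydrodynamicLimit.Theorems.CollisionIsometryCLTDiffuseBackwardInfluenceOnePathTransport

/-!
# `DiffuseBackwardInfluence`, line `share-nondegeneracy-one-flight`, stub `stub_onePathBound` (3/5): the tracer potentials of one source

Support file (`--supports stmt-AtomisticToContinuum-12950`). For the data `C : Src N` of one source `k`: the tracer law
`μ^n(i) = a_{ik}(n)/3` obeys the exchange rule in fraction form (`mu_succ_fst/snd`) and is a probability vector for every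
`n` (COLUMN BUDGET by conservation, registered sub-goal `onePath_column_budget`); the single and pair potentials `pot 1`,
`pot 2` with a counter of non-degenerate scores in the late slots are defined by primitive recursion from the restart
time `n₀`; proved: support, row sums, INVARIANT A (`pot_two_le`) and the RESTART BOUND (`excess_bound`).
-/

namespace Summit.AtomisticToContinuum.HydrodynamicLimit.Theorems.DiffuseBackwardInfluenceShare

open scoped BigOperators Topology ENNReal InnerProductSpace Classical
open Filter Set MeasureTheory
open Literature.Analysis.FluidPDE
open Literature.MathematicalPhysics.KineticTheory (localGibbsLaw hsDiameter)
open Summit.AtomisticToContinuum.HydrodynamicLimit.Theorems.DiffuseBackwardInfluenceNeg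

noncomputable section

namespace OnePath

/-! ## §4 The tracer potentials of one source -/

/-- The data fixed along the one-path argument for ONE source: density, initial configuration, window, share
non-degeneracy threshold, depth `m` (number of non-degenerate collisions asked for), inverse late fraction `L`, source. -/
structure Src (N : ℕ) where
  /-- reduced density -/ σ : ℝ
  /-- initial configuration -/ y : Cfg N
  /-- window length -/ Δ : ℝ
  /-- share non-degeneracy threshold -/ η : ℝ
  /-- depth -/ m : ℕ
  /-- inverse late fraction -/ L : ℕ
  /-- the source particle -/ k : Fin (N + 1)

section Potentials

variable {N : ℕ} (C : Src N)

/-- Slot starts of the grid with `2mL` slots. -/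
def nS (r : ℕ) : ℕ := slotStart C.σ N C.y C.Δ (2 * C.m * C.L) r

/-- The restart time `n₀`: the start of the last `2m` slots. -/
def n0 : ℕ := nS C (2 * C.m * C.L - 2 * C.m)

/-- The number of fold steps of the window. -/
def fin : ℕ := colls C.σ N C.y C.Δ

/-- The tracer law of the source after `n` fold steps: `μ(i) = a_{ik}(n) / 3`. -/
def mu (n : ℕ) (i : Fin (N + 1)) : ℝ := blockMass C.σ N C.y n i C.k / 3

/-- The handed-over fraction of particle `i` for the source at step `n` (along the realised unit normal). -/
def fr (n : ℕ) (i : Fin (N + 1)) : ℝ := shareFrac C.σ N C.y n i C.k (unitNormal C.σ N C.y n)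

/-- GOOD particles of slot `r` (a set): `i` collides in slot `r`, its FIRST collision there being `η`-ND for `(i, k)`. -/
def Good (r : ℕ) : Set (Fin (N + 1)) := fun i =>
  ∃ h : HasCollIn C.σ N C.y C.Δ (2 * C.m * C.L) r i,
    ¬ Degenerate C.η (blockMass C.σ N C.y (Nat.find h) i C.k)
      (blockShare C.σ N C.y (Nat.find h) i C.k (unitNormal C.σ N C.y (Nat.find h)))

/-- The first collision of `i` in slot `r` (junk `0` if there is none). -/
def cfirst (r : ℕ) (i : Fin (N + 1)) : ℕ :=
  if h : HasCollIn C.σ N C.y C.Δ (2 * C.m * C.L) r i then Nat.find h else 0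

/-- The set of LATE slots: the last `2m` of the `2mL` slots. -/
def Late : Set ℕ := fun r => 2 * C.m * C.L - 2 * C.m ≤ r ∧ r < 2 * C.m * C.L

/-- Particles SCORING at step `c` (a set): `c` is their first collision of some late slot and is `η`-ND for them. -/
def Scores (c : ℕ) : Set (Fin (N + 1)) := fun i => ∃ r, Late C r ∧ Good C r i ∧ cfirst C r i = c

/-- The potentials `t` steps after the restart (primitive recursion along the fold): `pot 1 t i j` = tracer mass at `i`
with `j` scores since `n₀`; `pot 2 t i j` = mass of PAIRS of conditionally independent tracers together at `i` with
identical moves since `n₀` and `j` scores (at `t = 0` every pair sitting together counts, whatever its past). -/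
def pot (e : ℕ) : ℕ → Fin (N + 1) → ℕ → ℝ
  | 0 => fun i j => if j = 0 then mu C (n0 C) i ^ e else 0
  | t + 1 =>
    if h : (pairsAt C.σ N C.y (n0 C + t)).Nonempty then
      transport e h.some.1 h.some.2 (fr C (n0 C + t)) (Scores C (n0 C + t)) (pot e t)
    else pot e t

variable {C}

/-- `pot` after a reflecting step. [folklore] -/
theorem pot_succ_of {t : ℕ} (h : (pairsAt C.σ N C.y (n0 C + t)).Nonempty) (e : ℕ) :
    pot C e (t + 1) = transport e h.some.1 h.some.2 (fr C (n0 C + t)) (Scores C (n0 C + t)) (pot C e t) := by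
  rw [pot, dif_pos h]

/-- `pot` after an idle step. [folklore] -/
theorem pot_succ_of_not {t : ℕ} (h : ¬ (pairsAt C.σ N C.y (n0 C + t)).Nonempty) (e : ℕ) :
    pot C e (t + 1) = pot C e t := by
  rw [pot, dif_neg h]

/-- `0 ≤ μ`. [folklore] -/
theorem mu_nonneg (n : ℕ) (i : Fin (N + 1)) : 0 ≤ mu C n i :=
  div_nonneg (blockMass_nonneg _ _ _ _ _ _) (by norm_num)

/-- `0 ≤ f`. [folklore] -/
theorem fr_nonneg (n : ℕ) (i : Fin (N + 1)) : 0 ≤ fr C n i := shareFrac_unitNormal_nonneg _ _ _ _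

/-- `f ≤ 1`. [folklore] -/
theorem fr_le_one (n : ℕ) (i : Fin (N + 1)) : fr C n i ≤ 1 := shareFrac_unitNormal_le_one _ _ _ _

/-- EXCHANGE RULE in tracer form, first endpoint: `μ'(p) = (1 − f_p) μ(p) + f_q μ(q)`. [folklore] -/
theorem mu_succ_fst {n : ℕ} (h : (pairsAt C.σ N C.y n).Nonempty) :
    mu C (n + 1) h.some.1 = (1 - fr C n h.some.1) * mu C n h.some.1 + fr C n h.some.2 * mu C n h.some.2 := by
  unfold mu fr
  rw [blockMass_succ_fst h]
  have h1 := shareFrac_mul_blockMass (σ := C.σ) C.y n h.some.1 C.k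
  have h2 := shareFrac_mul_blockMass (σ := C.σ) C.y n h.some.2 C.k
  linear_combination (1 / 3 : ℝ) * h1 - (1 / 3 : ℝ) * h2

/-- EXCHANGE RULE in tracer form, second endpoint: `μ'(q) = (1 − f_q) μ(q) + f_p μ(p)`. [folklore] -/
theorem mu_succ_snd {n : ℕ} (h : (pairsAt C.σ N C.y n).Nonempty) :
    mu C (n + 1) h.some.2 = (1 - fr C n h.some.2) * mu C n h.some.2 + fr C n h.some.1 * mu C n h.some.1 := by
  unfold mu fr
  rw [blockMass_succ_snd h]
  have h1 := shareFrac_mul_blockMass (σ := C.σ) C.y n h.some.1 C.k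
  have h2 := shareFrac_mul_blockMass (σ := C.σ) C.y n h.some.2 C.k
  linear_combination (1 / 3 : ℝ) * h2 - (1 / 3 : ℝ) * h1

/-- Tracer mass away from the reflected pair does not move. [folklore] -/
theorem mu_succ_of_ne {n : ℕ} {i : Fin (N + 1)} (hi : ∀ h : (pairsAt C.σ N C.y n).Nonempty, i ≠ h.some.1 ∧ i ≠ h.some.2) :
    mu C (n + 1) i = mu C n i := by
  unfold mu
  rw [blockMass_succ_of_ne hi]

/-- The tracer law after a reflecting step, as a two-point modification. [folklore] -/
theorem mu_succ_eq_ite {n : ℕ} (h : (pairsAt C.σ N C.y n).Nonempty) (i : Fin (N + 1)) :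
    mu C (n + 1) i =
      if i = h.some.1 then (1 - fr C n h.some.1) * mu C n h.some.1 + fr C n h.some.2 * mu C n h.some.2
      else if i = h.some.2 then (1 - fr C n h.some.2) * mu C n h.some.2 + fr C n h.some.1 * mu C n h.some.1
      else mu C n i := by
  by_cases hp : i = h.some.1
  · rw [if_pos hp, hp, mu_succ_fst h]
  by_cases hq : i = h.some.2
  · rw [if_neg hp, if_pos hq, hq, mu_succ_snd h]
  rw [if_neg hp, if_neg hq, mu_succ_of_ne (fun h' => ⟨hp, hq⟩)]

/-- COLUMN CONSERVATION: the total tracer mass is invariant under a fold step. [folklore] -/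
theorem sum_mu_succ (n : ℕ) : ∑ i, mu C (n + 1) i = ∑ i, mu C n i := by
  by_cases h : (pairsAt C.σ N C.y n).Nonempty
  · rw [sum_twoPoint (some_fst_ne_some_snd h) (mu C n) (mu C (n + 1)) _ _ (mu_succ_eq_ite h)]
    ring
  · exact Finset.sum_congr rfl fun i _ => mu_succ_of_ne (fun h' => absurd h' h)

/-- The initial tracer law is `δ_k`. [folklore] -/
theorem mu_zero (i : Fin (N + 1)) : mu C 0 i = if i = C.k then 1 else 0 := by
  unfold mu blockMass blockCol
  simp only [transferN_zero]
  by_cases hik : i = C.k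
  · subst hik
    have h1 : ∀ a : Fin 3, ‖(EuclideanSpace.single a (1 : ℝ) : V3)‖ ^ 2 = 1 := fun a => by simp
    simp only [Pi.single_eq_same, if_true, h1, Finset.sum_const, Finset.card_univ, Fintype.card_fin, nsmul_eq_mul]
    norm_num
  · simp [hik]

/-- COLUMN CONSERVATION: `Σ_i μ^n(i) = 1` for every `n` — the tracer law is a probability vector. [folklore] -/
theorem sum_mu (n : ℕ) : ∑ i, mu C n i = 1 := by
  induction n with
  | zero => simp [mu_zero]
  | succ n ih => rw [sum_mu_succ, ih]

/-- `μ ≤ 1`. [folklore] -/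
theorem mu_le_one (n : ℕ) (i : Fin (N + 1)) : mu C n i ≤ 1 := by
  rw [← sum_mu (C := C) n]
  exact Finset.single_le_sum (fun j _ => mu_nonneg n j) (Finset.mem_univ i)

/-- The potentials are nonnegative. [folklore] -/
theorem pot_nonneg (e t : ℕ) (i : Fin (N + 1)) (j : ℕ) : 0 ≤ pot C e t i j := by
  induction t generalizing i j with
  | zero =>
    simp only [pot]
    split_ifs
    · exact pow_nonneg (mu_nonneg _ _) _
    · exact le_rfl
  | succ t ih =>
    by_cases h : (pairsAt C.σ N C.y (n0 C + t)).Nonempty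
    · rw [pot_succ_of h]
      exact transport_nonneg (fr_nonneg _ _) (fr_le_one _ _) (fr_nonneg _ _) (fr_le_one _ _) ih e _ i j
    · rw [pot_succ_of_not h]
      exact ih i j

/-- Support: after `t` steps no counter exceeds `t`. [folklore] -/
theorem pot_eq_zero_of_lt (e t : ℕ) (i : Fin (N + 1)) (j : ℕ) (hj : t < j) : pot C e t i j = 0 := by
  induction t generalizing i j with
  | zero =>
    simp only [pot]
    rw [if_neg (by omega)]
  | succ t ih =>
    by_cases h : (pairsAt C.σ N C.y (n0 C + t)).Nonempty
    · rw [pot_succ_of h]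
      exact transport_eq_zero_of_lt (fun i j hj => ih i j hj) e _ _ _ _ i j hj
    · rw [pot_succ_of_not h]
      exact ih i j (by omega)

/-- ROW SUMS of the single potential: summing out the counter returns the tracer law. [folklore] -/
theorem sum_pot_one (K : ℕ) : ∀ t, t ≤ K → ∀ i, ∑ j ∈ Finset.range (K + 1), pot C 1 t i j = mu C (n0 C + t) i := by
  intro t
  induction t with
  | zero =>
    intro _ i
    simp only [pot, pow_one]
    rw [Finset.sum_ite_eq']
    simp
  | succ t ih =>
    intro ht i
    have hK : ∀ i', pot C 1 t i' K = 0 := fun i' => pot_eq_zero_of_lt 1 t i' K (by omega)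
    have ih' := ih (by omega)
    by_cases h : (pairsAt C.σ N C.y (n0 C + t)).Nonempty
    · rw [pot_succ_of h]
      have hpq := some_fst_ne_some_snd h
      by_cases hp : i = h.some.1
      · rw [hp, sum_transport_fst, ih', ih', pow_one, pow_one, ← add_assoc, mu_succ_fst h]
        exact hK
      by_cases hq : i = h.some.2
      · rw [hq, sum_transport_snd hpq, ih', ih', pow_one, pow_one, ← add_assoc, mu_succ_snd h]
        exact hK
      rw [← add_assoc, mu_succ_of_ne (fun h' => ⟨hp, hq⟩), ← ih' i]
      exact Finset.sum_congr rfl fun j _ => transport_of_ne hp hq _ _ _ _ _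
    · rw [pot_succ_of_not h, ← add_assoc, mu_succ_of_ne (fun h' => absurd h' h), ih' i]

/-- The single potential is dominated by the tracer law. [folklore] -/
theorem pot_one_le_mu (t : ℕ) (i : Fin (N + 1)) (j : ℕ) : pot C 1 t i j ≤ mu C (n0 C + t) i := by
  by_cases hj : t < j
  · rw [pot_eq_zero_of_lt 1 t i j hj]; exact mu_nonneg _ _
  · rw [← sum_pot_one (C := C) t t le_rfl i]
    exact Finset.single_le_sum (fun j' _ => pot_nonneg 1 t i j') (Finset.mem_range.2 (by omega))

/-! ### Invariant A: the pair potential dies at non-degenerate scores -/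

/-- A scoring particle's block is `η`-non-degenerate at the scoring step. [folklore] -/
theorem not_degenerate_of_scores {c : ℕ} {i : Fin (N + 1)} (hs : Scores C c i) :
    ¬ Degenerate C.η (blockMass C.σ N C.y c i C.k) (blockShare C.σ N C.y c i C.k (unitNormal C.σ N C.y c)) := by
  obtain ⟨r, _, ⟨h, hnd⟩, hc⟩ := hs
  unfold cfirst at hc
  rw [dif_pos h] at hc
  rwa [hc] at hnd

/-- At a scoring step the scoring particle carries no tracer mass or hands over a fraction in `[η, 1 − η]`. [folklore] -/
theorem fr_mem_of_scores {t : ℕ} {i : Fin (N + 1)} (hs : Scores C (n0 C + t) i) :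
    (∀ j, pot C 1 t i j = 0) ∨ (1 - fr C (n0 C + t) i ≤ 1 - C.η ∧ fr C (n0 C + t) i ≤ 1 - C.η) := by
  have hnd := not_degenerate_of_scores hs
  unfold Degenerate at hnd
  push_cast [not_or, not_lt] at hnd
  set a := blockMass C.σ N C.y (n0 C + t) i C.k with ha
  set x := blockShare C.σ N C.y (n0 C + t) i C.k (unitNormal C.σ N C.y (n0 C + t)) with hx
  by_cases h0 : a = 0
  · refine Or.inl fun j => ?_
    have hmu : mu C (n0 C + t) i = 0 := by unfold mu; rw [← ha, h0, zero_div]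
    exact le_antisymm (hmu ▸ pot_one_le_mu t i j) (pot_nonneg 1 t i j)
  · have hapos : 0 < a := lt_of_le_of_ne (blockMass_nonneg _ _ _ _ _ _) (Ne.symm h0)
    refine Or.inr ⟨?_, (div_le_iff₀ hapos).2 hnd.2⟩
    have : C.η ≤ x / a := by rw [le_div_iff₀ hapos]; exact hnd.1
    change 1 - x / a ≤ 1 - C.η
    linarith

/-- INVARIANT A: `χ_t(i, j) ≤ (1 − η)^j φ_t(i, j)` — unsplit pairs die geometrically in the number of scores. [folklore] -/
theorem pot_two_le (hη1 : C.η ≤ 1) :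
    ∀ t i j, pot C 2 t i j ≤ (1 - C.η) ^ j * pot C 1 t i j := by
  intro t
  induction t with
  | zero =>
    intro i j
    simp only [pot]
    split_ifs with hj
    · subst hj
      rw [pow_zero, one_mul, pow_one]
      nlinarith [mu_nonneg (C := C) (n0 C) i, mu_le_one (C := C) (n0 C) i]
    · simp
  | succ t ih =>
    intro i j
    by_cases h : (pairsAt C.σ N C.y (n0 C + t)).Nonempty
    · rw [pot_succ_of h, pot_succ_of h]
      exact transport_two_le (some_fst_ne_some_snd h) (sub_nonneg.2 hη1) (fr_nonneg _ _) (fr_le_one _ _)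
        (fr_nonneg _ _) (fr_le_one _ _) (fun i j => pot_nonneg 1 t i j) ih fr_mem_of_scores
        fr_mem_of_scores i j
    · rw [pot_succ_of_not h, pot_succ_of_not h]
      exact ih i j

/-! ### The merge identity: together-mass ≤ never-split pair mass + late merges -/

/-- `mergeAt` in tracer form. [folklore] -/
theorem mergeAt_eq {c : ℕ} (h : (pairsAt C.σ N C.y c).Nonempty) :
    mergeAt C.σ N C.y C.k c = 2 * mu C c h.some.1 * mu C c h.some.2 *
      (fr C c h.some.1 * (1 - fr C c h.some.2) + fr C c h.some.2 * (1 - fr C c h.some.1)) := by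
  unfold mergeAt mu fr
  rw [dif_pos h]

/-- Merge masses are nonnegative. [folklore] -/
theorem mergeAt_src_nonneg (c : ℕ) : 0 ≤ mergeAt C.σ N C.y C.k c := by
  by_cases h : (pairsAt C.σ N C.y c).Nonempty
  · rw [mergeAt_eq h]
    have h3 := fr_le_one (C := C) c h.some.1
    have h4 := fr_le_one (C := C) c h.some.2
    refine mul_nonneg (mul_nonneg (mul_nonneg (by norm_num) (mu_nonneg c _)) (mu_nonneg c _)) ?_
    exact add_nonneg (mul_nonneg (fr_nonneg c _) (by linarith)) (mul_nonneg (fr_nonneg c _) (by linarith))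
  · rw [mergeAt_of_not_nonempty h]

/-- RESTART BOUND: the excess of the together-mass `μ(i)²` over the never-split pair mass is nonnegative sitewise and
its total is at most the merge mass accumulated since the restart. [folklore] -/
theorem excess_bound (K : ℕ) : ∀ t, t ≤ K →
    (∀ i, ∑ j ∈ Finset.range (K + 1), pot C 2 t i j ≤ mu C (n0 C + t) i ^ 2) ∧
    ∑ i, (mu C (n0 C + t) i ^ 2 - ∑ j ∈ Finset.range (K + 1), pot C 2 t i j) ≤
      ∑ c ∈ Finset.Ico (n0 C) (n0 C + t), mergeAt C.σ N C.y C.k c := by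
  intro t
  induction t with
  | zero =>
    intro _
    have h0 : ∀ i, ∑ j ∈ Finset.range (K + 1), pot C 2 0 i j = mu C (n0 C) i ^ 2 := fun i => by
      simp only [pot]
      rw [Finset.sum_ite_eq']
      simp
    refine ⟨fun i => (h0 i).le, ?_⟩
    simp [h0]
  | succ t ih =>
    intro ht
    obtain ⟨ih1, ih2⟩ := ih (by omega)
    have hK : ∀ i', pot C 2 t i' K = 0 := fun i' => pot_eq_zero_of_lt 2 t i' K (by omega)
    rw [show n0 C + (t + 1) = n0 C + t + 1 from rfl]
    by_cases h : (pairsAt C.σ N C.y (n0 C + t)).Nonempty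
    · have hpq := some_fst_ne_some_snd h
      set p := h.some.1 with hp
      set q := h.some.2 with hq
      set nu : Fin (N + 1) → ℝ := fun i => ∑ j ∈ Finset.range (K + 1), pot C 2 t i j with hnu
      set nu' : Fin (N + 1) → ℝ := fun i => ∑ j ∈ Finset.range (K + 1), pot C 2 (t + 1) i j with hnu'
      have hnup : nu' p = (1 - fr C (n0 C + t) p) ^ 2 * nu p + fr C (n0 C + t) q ^ 2 * nu q := by
        simp only [hnu', hnu, pot_succ_of h]
        exact sum_transport_fst 2 p q _ _ _ K hK
      have hnuq : nu' q = (1 - fr C (n0 C + t) q) ^ 2 * nu q + fr C (n0 C + t) p ^ 2 * nu p := by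
        simp only [hnu', hnu, pot_succ_of h]
        exact sum_transport_snd hpq 2 _ _ _ K hK
      have hnui : ∀ i, i ≠ p → i ≠ q → nu' i = nu i := fun i hip hiq => by
        simp only [hnu', hnu, pot_succ_of h]
        exact Finset.sum_congr rfl fun j _ => transport_of_ne hip hiq _ _ _ _ _
      have hmp : mu C (n0 C + t + 1) p =
          (1 - fr C (n0 C + t) p) * mu C (n0 C + t) p + fr C (n0 C + t) q * mu C (n0 C + t) q :=
        mu_succ_fst h
      have hmq : mu C (n0 C + t + 1) q =
          (1 - fr C (n0 C + t) q) * mu C (n0 C + t) q + fr C (n0 C + t) p * mu C (n0 C + t) p :=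
        mu_succ_snd h
      have hmi : ∀ i, i ≠ p → i ≠ q → mu C (n0 C + t + 1) i = mu C (n0 C + t) i := fun i hip hiq =>
        mu_succ_of_ne (fun h' => ⟨hip, hiq⟩)
      obtain ⟨e1, e2, e3⟩ := excess_step (fr_nonneg (C := C) (n0 C + t) p) (fr_le_one (C := C) (n0 C + t) p)
        (fr_nonneg (C := C) (n0 C + t) q) (fr_le_one (C := C) (n0 C + t) q) (mu_nonneg (C := C) (n0 C + t) p)
        (mu_nonneg (C := C) (n0 C + t) q) (ih1 p) (ih1 q)
      refine ⟨fun i => ?_, ?_⟩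
      · show nu' i ≤ _
        by_cases hip : i = p
        · rw [hip, hnup, hmp]; exact e1
        by_cases hiq : i = q
        · rw [hiq, hnuq, hmq]; exact e2
        rw [hnui i hip hiq, hmi i hip hiq]; exact ih1 i
      · show ∑ i, (mu C (n0 C + t + 1) i ^ 2 - nu' i) ≤ _
        rw [sum_twoPoint hpq (fun i => mu C (n0 C + t) i ^ 2 - nu i) (fun i => mu C (n0 C + t + 1) i ^ 2 - nu' i)
          (mu C (n0 C + t + 1) p ^ 2 - nu' p) (mu C (n0 C + t + 1) q ^ 2 - nu' q) ?_]
        · rw [Finset.sum_Ico_succ_top (Nat.le_add_right _ _), mergeAt_eq h, hnup, hnuq, hmp, hmq]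
          change ∑ i, (mu C (n0 C + t) i ^ 2 - nu i) ≤ _ at ih2
          nlinarith [e3, ih2]
        · intro i
          by_cases hip : i = p
          · rw [if_pos hip, hip]
          by_cases hiq : i = q
          · rw [if_neg hip, if_pos hiq, hiq]
          rw [if_neg hip, if_neg hiq, hnui i hip hiq, hmi i hip hiq]
    · have hmi : ∀ i, mu C (n0 C + t + 1) i = mu C (n0 C + t) i := fun i =>
        mu_succ_of_ne (fun h' => absurd h' h)
      simp only [pot_succ_of_not h, hmi]
      refine ⟨ih1, ?_⟩
      rw [Finset.sum_Ico_succ_top (Nat.le_add_right _ _), mergeAt_of_not_nonempty h, add_zero]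
      exact ih2

end Potentials

end OnePath

/-- COLUMN BUDGET (registered sub-goal): `Σ_i a_{ik}(n) = 3` for all `n` — conservation under the exchange rule. [folklore] -/
theorem onePath_column_budget : ∀ (σ : ℝ) (N : ℕ) (y : Cfg N) (n : ℕ) (k : Fin (N + 1)), ∑ i : Fin (N + 1), blockMass σ N y n i k = 3 := by
  intro σ N y n k
  have h := OnePath.sum_mu (C := (⟨σ, y, 0, 0, 0, 0, k⟩ : OnePath.Src N)) n
  simp only [OnePath.mu, ← Finset.sum_div] at h
  linarith

end

end Summit.AtomisticToContinuum.HydrodynamicLimit.Theorems.DiffuseBackwardInfluenceShare
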